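import Literature.NumberTheory.Transcendental.PeriodConjecture
import Literature.NumberTheory.Transcendental.KZCalculusProofs
import HarnessLib

/-!
# The Kontsevich–Zagier period conjecture: kernel form versus two-representation forms

`Literature.NumberTheory.Transcendental.KZKernelConjecture` (file `PeriodConjecture.lean`) is the
*kernel form* of the Kontsevich–Zagier period conjecture over the calculus of moves of
`KZCalculus.lean`: `ker (KZ.eval : KZ.FormalRep →+ ℝ) = KZ.relations`, i.e. the evaluation map from
the group of formal `ℤ`-combinations of integral representations modulo the moves to `ℝ` is
injective. This is Conjecture 1 of [Kontsevich–Zagier 2001, §1.2] ("if a period has two integral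
representations, then one can pass from one formula to another using only rules 1), 2), 3) in
which all functions and domains of integration are algebraic with coefficients in `ℚ̄`") in the
shape of [Huber–Müller-Stach 2017, Conj. 13.2.1] ("the evaluation map `P̃(k) → P(k)` is bijective";
Remark 13.2.2: it is surjective, "injectivity is the true issue").

**Status: open.** The conjecture is an open problem — "the Period Conjecture itself seems currently
far out of reach. Even the special case of values of the Riemann ζ-functions is widely open"
[Huber–Wüstholz 2022, Prologue p. xvii]; "up to our knowledge, there is no strategy of proof for
the KZ-conjecture" [Cresson–Viu-Sos 2022, §1]. Accordingly `KZKernelConjecture` is a `def … : Prop`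
and no `KZKernelConjecture_holds` can be offered (CONVENTIONS §4). What *is* provable, and is proved
in this file, is that the three Literature-side forms of the conjecture agree:

* `KZKernelConjecture.kzPeriodConjecture'` — kernel form ⇒ two-representation form with
  algebraic (`ℚ`-semialgebraic) endpoints `KZPeriodConjecture'` (take `c = [r] − [r']`);
* `KZKernelConjecture.of_kzPeriodConjecture'` — the converse, by the bookkeeping fact
  `KZ.exists_integralRep_sub` (every formal combination is `≡ [r] − [r']` modulo moves, discharged
  in `KZCalculusProofs.lean`) and soundness `KZ.relations_le_ker_eval`;
* `kzKernelConjecture_iff_kzPeriodConjecture'` — the equivalence;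
* `kzPeriodConjecture'_iff_isRational`, `kzKernelConjecture_iff_isRational` — both are further
  equivalent to the form with endpoints of KZ's literal shape (§1.1 Definition: integrand a quotient
  of `ℚ`-polynomials, `KZ.IntegralRep.IsRational`), by "algebraic integrands reduce to rational
  ones" `KZ.exists_isRational_equivalent` (KZ §1.1, remark after the Definition; discharged in
  `KZCalculusProofs.lean`).

These are the comparison lemmas announced in the module docstring of `PeriodConjecture.lean`.

## References

* M. Kontsevich, D. Zagier, *Periods*, in: Mathematics Unlimited — 2001 and Beyond, Springer
  (2001), 771–808, §1.2, Conjecture 1.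
* A. Huber, S. Müller-Stach, *Periods and Nori Motives*, Springer (2017), §13.2, Conj. 13.2.1,
  Rem. 13.2.2.
* A. Huber, G. Wüstholz, *Transcendence and Linear Relations of 1-Periods*, CUP (2022), Prologue.
* J. Cresson, J. Viu-Sos, *On the equality of periods of Kontsevich–Zagier*, JTNB 34 (2022), §§1–2.

## Design notes

* Theorems only; no definition is added and no statement is changed. The rational-endpoint form is
  written out as a `∀`-statement in the theorem types rather than named, since naming it would
  restate a problem statement kept under `Summits/`.
-/

noncomputable section

namespace Literature.NumberTheory.Transcendental

variable {n m : ℕ}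

/-- The value of `[r] − [r']` under `KZ.eval` is `r.value − r'.value`. [cite: KontsevichZagier2001, §1.2] -/
theorem KZ.eval_of_sub_of (r : KZ.IntegralRep n) (r' : KZ.IntegralRep m) :
    KZ.eval (KZ.of r - KZ.of r') = r.value - r'.value := by
  rw [map_sub, KZ.eval_of, KZ.eval_of]

/-- **Kernel form ⇒ two-representation form.** If `ker eval = relations`, then any two integral
representations (with `ℚ`-semialgebraic data) of the same real number are equivalent under the
moves: apply the kernel statement to `c = [r] − [r']`. [Kontsevich–Zagier 2001, §1.2, Conjecture 1;
Huber–Müller-Stach 2017, Conj. 13.2.1] [cite: KontsevichZagier2001, §1.2 Conjecture 1] -/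
theorem KZKernelConjecture.kzPeriodConjecture' (h : KZKernelConjecture) : KZPeriodConjecture' := by
  intro n m r r' hv
  apply h
  rw [KZ.eval_of_sub_of, hv, sub_self]

/-- **Two-representation form ⇒ kernel form.** If any two representations of the same number are
equivalent, then every formal combination `c` with `eval c = 0` is a relation: by
`KZ.exists_integralRep_sub` one has `c ≡ [r] − [r']` modulo relations, soundness
(`KZ.relations_le_ker_eval`) gives `r.value = r'.value`, hence `[r] − [r'] ∈ relations` and so is `c`.
[Kontsevich–Zagier 2001, §1.2, Conjecture 1; Huber–Müller-Stach 2017, Conj. 13.2.1]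
[cite: KontsevichZagier2001, §1.2 Conjecture 1] -/
theorem KZKernelConjecture.of_kzPeriodConjecture' (h : KZPeriodConjecture') : KZKernelConjecture := by
  intro c hc
  obtain ⟨n, m, r, r', hrel⟩ := KZ.exists_integralRep_sub_holds c
  have hker : KZ.eval (c - (KZ.of r - KZ.of r')) = 0 := KZ.relations_le_ker_eval_holds hrel
  rw [map_sub, hc, zero_sub, neg_eq_zero, KZ.eval_of_sub_of, sub_eq_zero] at hker
  have hE : KZ.Equivalent r r' := h r r' hker
  have := KZ.relations.add_mem hrel hE
  simpa using this

/-- **Kernel form ⇔ two-representation form** of the Kontsevich–Zagier period conjecture over the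
calculus of `KZCalculus.lean` (both with `ℚ`-semialgebraic endpoints).
[Kontsevich–Zagier 2001, §1.2, Conjecture 1; Huber–Müller-Stach 2017, Conj. 13.2.1]
[cite: KontsevichZagier2001, §1.2 Conjecture 1] -/
theorem kzKernelConjecture_iff_kzPeriodConjecture' : KZKernelConjecture ↔ KZPeriodConjecture' :=
  ⟨KZKernelConjecture.kzPeriodConjecture', KZKernelConjecture.of_kzPeriodConjecture'⟩

/-- **Algebraic versus rational endpoints.** The two-representation form for all representations
with `ℚ`-semialgebraic (real-algebraic) data is equivalent to the same statement restricted to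
representations of KZ's literal shape (integrand a quotient of `ℚ`-polynomials,
`KZ.IntegralRep.IsRational`): every representation is equivalent by the moves to a rational-shape
one (`KZ.exists_isRational_equivalent`, KZ §1.1 remark after the Definition), and equivalent
representations have equal values (`KZ.Equivalent.value_eq`).
[Kontsevich–Zagier 2001, §1.1 (remark after the Definition), §1.2 Conjecture 1]
[cite: KontsevichZagier2001, §1.2 Conjecture 1] -/
theorem kzPeriodConjecture'_iff_isRational :
    KZPeriodConjecture' ↔
      ∀ ⦃n m : ℕ⦄ (r : KZ.IntegralRep n) (r' : KZ.IntegralRep m),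
        r.IsRational → r'.IsRational → r.value = r'.value → KZ.Equivalent r r' := by
  constructor
  · intro h n m r r' _ _ hv
    exact h r r' hv
  · intro h n m r r' hv
    obtain ⟨N, R, hR, hrR⟩ := KZ.exists_isRational_equivalent_holds r
    obtain ⟨N', R', hR', hrR'⟩ := KZ.exists_isRational_equivalent_holds r'
    have hvR : R.value = R'.value := by
      rw [← KZ.Equivalent.value_eq_holds hrR, ← KZ.Equivalent.value_eq_holds hrR', hv]
    exact (hrR.trans (h R R' hR hR' hvR)).trans hrR'.symm

/-- **Kernel form ⇔ KZ-literal form.** `ker eval = relations` holds if and only if any two integral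
representations of KZ's literal shape (§1.1 Definition: rational integrand over a
`ℚ`-semialgebraic domain) with the same value are connected by the moves — the printed shape of
Conjecture 1. [Kontsevich–Zagier 2001, §1.1–1.2, Conjecture 1; Huber–Müller-Stach 2017,
Conj. 13.2.1] [cite: KontsevichZagier2001, §1.2 Conjecture 1] -/
theorem kzKernelConjecture_iff_isRational :
    KZKernelConjecture ↔
      ∀ ⦃n m : ℕ⦄ (r : KZ.IntegralRep n) (r' : KZ.IntegralRep m),
        r.IsRational → r'.IsRational → r.value = r'.value → KZ.Equivalent r r' :=
  kzKernelConjecture_iff_kzPeriodConjecture'.trans kzPeriodConjecture'_iff_isRational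

end Literature.NumberTheory.Transcendental
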